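import Summits.QuantumFields.BalabanUV.Beta.GAN24.ExplicitSourceFormLambdaShare
import Summits.QuantumFields.BalabanUV.Beta.GAN24.SourcePairingLevelExplicit

/-!
# `BalabanUV.Beta.GAN24.SlotMomentExitPairLevels` — binder row G-an2-4 ∕ (CONV-C), route C-R7° (S) display: **THE EXIT⊗EXIT σ-PAIR (S) ROW AT EVERY LEVEL `j + 1`, WITH NO
# DISPLAYED IDENTITY** — MY gen-44 `ExplicitSourceFormLambdaShare.moments_sigmaPair_exit_succ_of_columnPairing` at every `j` with its `hX` binder DISCHARGED by leaf-06 g50's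
# `SourcePairingLevelExplicit.columnPairing_explicitSourceForm` (F3′; at `j = 0` her A-4 `columnPairing_levelOne_explicitSourceForm`) (road-P2 chair of row G-an2-4, unit `b2b-balaban-gan24-p2` gen 45, crux team (2); [GAN24P2-G45-INTENT3])

NOT IN PRINT; OUR BOOKKEEPING ([folklore] ONE composition BY NAME; 0 `def`, 0 cited facts, 0 `def … : Prop`, 0 sorry).  HONEST FRAMING (cell contract, verbatim): «discharging
`BetaPertH` makes Bałaban's UV stability UNCONDITIONAL — a real constructive-QFT result; it is NOT the continuum limit and NOT the Clay problem.»  HONEST DEPENDENCY (verbatim):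
«continuum YM on T⁴ ⇐ BetaPertH ∧ nine spine estimates (0/9 proved); BetaPertH ⇐ (D1) ∧ (D4) ∧ CAP+tail; G-an2-4 gates asym, D1 and NE2/3/4.»
WHAT: §1 **`moments_sigmaPair_exit_succ`** (`Lc` odd, centred root `ρ_c = toSite (ctrOff (d+1) Lc)`, pins `cE = Lc^{d+1}`, `cVH = −(Lc^{d+1}·½·Lc^{d+1})`, EVERY `cΛ`, EVERY
level `j`, `α ≠ β`, every `y ν`; generic `d`): `(Σ'_{y′} Z_j(y′) = 0) ∧ ∀ λ, Σ'_{y′} (y′ − y)_λ·Z_j(y′) = 0`, `Z_j = Vα − ½(stepScale_{j+1}·Lc^{d+1})⁻¹·Qc`, the profiles `Vα Vend Qc`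
bound by their defining equations at level `j + 1` (instantiate with `fun _ => rfl`) — the zeroth and first moments of the exit⊗exit σ-pair's (S)-row profile vanish at
every level, NO displayed identity left (gen-44's `hX` is leaf-06's theorem).  §2 `moments_sigmaPair_exit_one` = §1 at `j := 0` (the name announced in INTENT 3).
(W-γ)'s other rows, (INV), (Π) NOT discharged; NEVER «G-an2-4 closed» as (CONV-C); NOT NE2∕NE3, NOT D1, NOT `BetaPertH`, NOT continuum, NOT Clay; not in print — our
bookkeeping.  2026-08-23.
-/

noncomputable section

open Finset
open scoped BigOperators
open Literature.MathematicalPhysics.QuantumFieldTheory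
open Literature.MathematicalPhysics.QuantumFieldTheory.Balaban1983to89
open Literature.MathematicalPhysics.QuantumFieldTheory.Balaban1983to89.Beta
open ExpKernelCalculus (Site MKer comp)
open AffineAveraging (Form0 Form1 box toSite unitVec unitVec_apply dz contourSum)
open AveragingContours (blk axial axial_sum_sub axial_sum_grad grad_eq_dz)
open AveragingContoursRooted (treeGaugeAt ctrOff ctrOff_mem_box)
open RootedComb (axProjAt axProjAt_apply treeGaugeAt_eq_zero_of_axialGaugeAt)
open KernelSpecInstance (wΦ)
open OneStepResolventKernel (Fib)
open OneStepKernelFamily (KInvStep colH)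
open SecondOrderResponse (colM dM)
open BalabanStepW2 (wM1)
open BalabanStepJetsSucc (wE wVH)
open Summit.QuantumFields.BalabanUV.Beta.BorderedHessian (stepScale)
open Summit.QuantumFields.BalabanUV.Beta.AxialDressingRooted (IsCombBondAt coDressKBmAt axProjAt_eq_zero_of_isCombBond one_le_of_neZero)
open Summit.QuantumFields.BalabanUV.Beta.SpineRooted (SpureRecAt M1At e3OfK)
open Summit.QuantumFields.BalabanUV.Beta.WardLocusRecursive (SrecAt)
open Summit.QuantumFields.BalabanUV.Beta.KernelWardRelative (gaugeWt)
open Summit.QuantumFields.BalabanUV.Beta.GAN24.CombFreeGaugeLegCharges (axialGaugeAt_of_comb_zero axProjAt_eq_self_of_comb_zero)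
open Summit.QuantumFields.BalabanUV.Beta.GAN24.EdgePlaquettePotential (edgePotential_apply)
open Summit.QuantumFields.BalabanUV.Beta.GAN24.EdgePotentialAxialGauge (resid_add_unitVec combFreeEdgePotential_apply combFreeEdgePotential_comb_zero)
open Summit.QuantumFields.BalabanUV.Beta.GAN24.GaugeReadExitPairing (contourSum_sourceForm_eq_zero not_isCombBondAt_of_exit)
open Summit.QuantumFields.BalabanUV.Beta.GAN24.ExitDefectContourSums (contourSum_bondSum_blockInd_eq_zero)
open Summit.QuantumFields.BalabanUV.Beta.GAN24.WardGammaExitExplicitPotential (explicitPotential_add_zsmul)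
open Summit.QuantumFields.BalabanUV.Beta.GAN24.SlotMomentExitPairOfSourcePairing (moments_sigmaPair_exit_succ_of_reducedPairing)
open Summit.QuantumFields.BalabanUV.Beta.GAN24.ExplicitSourceFormLambdaShare (moments_sigmaPair_exit_succ_of_columnPairing)
open Summit.QuantumFields.BalabanUV.Beta.GAN24.SourcePairingLevelExplicit (columnPairing_explicitSourceForm)

namespace Summit.QuantumFields.BalabanUV.Beta.GAN24.SlotMomentExitPairLevels

variable {d : ℕ} {Lc : ℕ} [NeZero Lc]

/-- NOT IN PRINT; OUR BOOKKEEPING ([folklore] composition).  **THE (S) ROW AT EVERY LEVEL `j + 1` FOR THE EXIT⊗EXIT σ-PAIR, UNCONDITIONALLY AT THE PINS** (centred root, `Lc` odd,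
`α ≠ β`, every `cΛ y ν`): MY `moments_sigmaPair_exit_succ_of_columnPairing hLc (Lc^{d+1}) (−(Lc^{d+1}·½·Lc^{d+1})) cΛ j …` with `hX :=` leaf-06 g50's
`SourcePairingLevelExplicit.columnPairing_explicitSourceForm` (every `j`). -/
theorem moments_sigmaPair_exit_succ (hLc : Odd Lc) (cΛ : ℝ) (j : ℕ) (y : Site (d + 1)) (ν : Fin (d + 1)) {α β : Fin (d + 1)} (hαβ : α ≠ β)
    {Vα Vend Qc : Site (d + 1) → ℝ}
    (hVα : ∀ y' : Site (d + 1), Vα y' = ((1 / 2 : ℝ) *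
        ((∑ κ : Fin (d + 1), ∑' u : Site (d + 1),
            colH (coDressKBmAt (toSite (ctrOff (d + 1) Lc)) Lc (KInvStep (d := d) Lc (j + 1))) Lc ν y' κ u
              * ((if y' = y then (1 / 2 : ℝ) else 0) - (if blk Lc u = y then (1 / 2 : ℝ) else 0))
              * ∑' xz : Site (d + 1) × Site (d + 1), ((if xz.1 α % (Lc : ℤ) = (Lc : ℤ) - 1 then (1 : ℝ) else 0) * (if xz.2 β % (Lc : ℤ) = (Lc : ℤ) - 1 then (1 : ℝ) else 0))
            * SpureRecAt d Lc (toSite (ctrOff (d + 1) Lc)) ((Lc : ℝ) ^ (d + 1)) (-((Lc : ℝ) ^ (d + 1) * (1 / 2) * (Lc : ℝ) ^ (d + 1))) cΛ (j + 1) κ u xz.1 xz.2 (Sum.inl α) (Sum.inl β))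
          + ∑ ρ' : Fin (d + 1), ∑' w : Site (d + 1),
            colM (coDressKBmAt (toSite (ctrOff (d + 1) Lc)) Lc (KInvStep (d := d) Lc (j + 1))) Lc ν y' ρ' w
              * ((if y' = y then (1 / 2 : ℝ) else 0) - (if w = y then (1 / 2 : ℝ) else 0))
              * ∑' xz : Site (d + 1) × Site (d + 1), ((if xz.1 α % (Lc : ℤ) = (Lc : ℤ) - 1 then (1 : ℝ) else 0) * (if xz.2 β % (Lc : ℤ) = (Lc : ℤ) - 1 then (1 : ℝ) else 0))
            * M1At d Lc (toSite (ctrOff (d + 1) Lc)) cΛ (j + 1) ρ' w xz.1 xz.2 (Sum.inl α) (Sum.inl β))))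
    (hVend : ∀ y' : Site (d + 1), Vend y' = ((1 / 2 : ℝ) *
        ((∑ κ : Fin (d + 1), ∑' u : Site (d + 1),
            colH (coDressKBmAt (toSite (ctrOff (d + 1) Lc)) Lc (KInvStep (d := d) Lc (j + 1))) Lc ν y' κ u
              * ((if y' + Pi.single ν 1 = y then (1 / 2 : ℝ) else 0) - (if blk Lc (u + Pi.single κ 1) = y then (1 / 2 : ℝ) else 0))
              * ∑' xz : Site (d + 1) × Site (d + 1), ((if xz.1 α % (Lc : ℤ) = (Lc : ℤ) - 1 then (1 : ℝ) else 0) * (if xz.2 β % (Lc : ℤ) = (Lc : ℤ) - 1 then (1 : ℝ) else 0))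
            * SpureRecAt d Lc (toSite (ctrOff (d + 1) Lc)) ((Lc : ℝ) ^ (d + 1)) (-((Lc : ℝ) ^ (d + 1) * (1 / 2) * (Lc : ℝ) ^ (d + 1))) cΛ (j + 1) κ u xz.1 xz.2 (Sum.inl α) (Sum.inl β))
          + ∑ ρ' : Fin (d + 1), ∑' w : Site (d + 1),
            colM (coDressKBmAt (toSite (ctrOff (d + 1) Lc)) Lc (KInvStep (d := d) Lc (j + 1))) Lc ν y' ρ' w
              * ((if y' + Pi.single ν 1 = y then (1 / 2 : ℝ) else 0) - (if w + Pi.single ρ' 1 = y then (1 / 2 : ℝ) else 0))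
              * ∑' xz : Site (d + 1) × Site (d + 1), ((if xz.1 α % (Lc : ℤ) = (Lc : ℤ) - 1 then (1 : ℝ) else 0) * (if xz.2 β % (Lc : ℤ) = (Lc : ℤ) - 1 then (1 : ℝ) else 0))
            * M1At d Lc (toSite (ctrOff (d + 1) Lc)) cΛ (j + 1) ρ' w xz.1 xz.2 (Sum.inl α) (Sum.inl β))))
    (hQc : ∀ y' : Site (d + 1), Qc y' = (∑ κ : Fin (d + 1), ∑' u : Site (d + 1),
        (∑' x₂, ∑ κ₂, comp (coDressKBmAt (toSite (ctrOff (d + 1) Lc)) Lc (KInvStep (d := d) Lc (j + 1)))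
            (dM (coDressKBmAt (toSite (ctrOff (d + 1) Lc)) Lc (KInvStep (d := d) Lc (j + 1))) Lc (SpureRecAt d Lc (toSite (ctrOff (d + 1) Lc)) ((Lc : ℝ) ^ (d + 1)) (-((Lc : ℝ) ^ (d + 1) * (1 / 2) * (Lc : ℝ) ^ (d + 1))) cΛ (j + 1)) (M1At d Lc (toSite (ctrOff (d + 1) Lc)) cΛ (j + 1)) ν y')
            u x₂ (Sum.inl κ) (Sum.inl κ₂) * gaugeWt Lc y κ₂ x₂)
          * ∑' xz : Site (d + 1) × Site (d + 1), ((if xz.1 α % (Lc : ℤ) = (Lc : ℤ) - 1 then (1 : ℝ) else 0) * (if xz.2 β % (Lc : ℤ) = (Lc : ℤ) - 1 then (1 : ℝ) else 0))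
            * SpureRecAt d Lc (toSite (ctrOff (d + 1) Lc)) ((Lc : ℝ) ^ (d + 1)) (-((Lc : ℝ) ^ (d + 1) * (1 / 2) * (Lc : ℝ) ^ (d + 1))) cΛ (j + 1) κ u xz.1 xz.2 (Sum.inl α) (Sum.inl β)
      + ∑ ρ' : Fin (d + 1), ∑' w : Site (d + 1),
        (∑' x₂, ∑ κ₂, comp (coDressKBmAt (toSite (ctrOff (d + 1) Lc)) Lc (KInvStep (d := d) Lc (j + 1)))
            (dM (coDressKBmAt (toSite (ctrOff (d + 1) Lc)) Lc (KInvStep (d := d) Lc (j + 1))) Lc (SpureRecAt d Lc (toSite (ctrOff (d + 1) Lc)) ((Lc : ℝ) ^ (d + 1)) (-((Lc : ℝ) ^ (d + 1) * (1 / 2) * (Lc : ℝ) ^ (d + 1))) cΛ (j + 1)) (M1At d Lc (toSite (ctrOff (d + 1) Lc)) cΛ (j + 1)) ν y')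
            ((Lc : ℤ) • w) x₂ (Sum.inr ρ') (Sum.inl κ₂) * gaugeWt Lc y κ₂ x₂)
          * ∑' xz : Site (d + 1) × Site (d + 1), ((if xz.1 α % (Lc : ℤ) = (Lc : ℤ) - 1 then (1 : ℝ) else 0) * (if xz.2 β % (Lc : ℤ) = (Lc : ℤ) - 1 then (1 : ℝ) else 0))
            * M1At d Lc (toSite (ctrOff (d + 1) Lc)) cΛ (j + 1) ρ' w xz.1 xz.2 (Sum.inl α) (Sum.inl β))) :
    (∑' y' : Site (d + 1), (Vα y' - (1 / 2 : ℝ) * (stepScale d Lc (j + 1) * (Lc : ℝ) ^ (d + 1))⁻¹ * Qc y') = 0)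
      ∧ ∀ lam : Fin (d + 1),
        ∑' y' : Site (d + 1), (((y' - y) lam : ℤ) : ℝ) * (Vα y' - (1 / 2 : ℝ) * (stepScale d Lc (j + 1) * (Lc : ℝ) ^ (d + 1))⁻¹ * Qc y') = 0 :=
  moments_sigmaPair_exit_succ_of_columnPairing hLc ((Lc : ℝ) ^ (d + 1)) (-((Lc : ℝ) ^ (d + 1) * (1 / 2) * (Lc : ℝ) ^ (d + 1))) cΛ j y ν hαβ hVα hVend hQc
    (fun y' c hC => columnPairing_explicitSourceForm hLc cΛ j y ν hαβ y' c hC)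

/-- NOT IN PRINT; OUR BOOKKEEPING (§1 at `j := 0`).  **THE (S) ROW AT LEVEL `0 + 1` FOR THE EXIT⊗EXIT σ-PAIR, UNCONDITIONALLY AT THE PINS** — the name announced in
[GAN24P2-G45-INTENT3]; kept for consumers reading level one. -/
theorem moments_sigmaPair_exit_one (hLc : Odd Lc) (cΛ : ℝ) (y : Site (d + 1)) (ν : Fin (d + 1)) {α β : Fin (d + 1)} (hαβ : α ≠ β)
    {Vα Vend Qc : Site (d + 1) → ℝ}
    (hVα : ∀ y' : Site (d + 1), Vα y' = ((1 / 2 : ℝ) *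
        ((∑ κ : Fin (d + 1), ∑' u : Site (d + 1),
            colH (coDressKBmAt (toSite (ctrOff (d + 1) Lc)) Lc (KInvStep (d := d) Lc (0 + 1))) Lc ν y' κ u
              * ((if y' = y then (1 / 2 : ℝ) else 0) - (if blk Lc u = y then (1 / 2 : ℝ) else 0))
              * ∑' xz : Site (d + 1) × Site (d + 1), ((if xz.1 α % (Lc : ℤ) = (Lc : ℤ) - 1 then (1 : ℝ) else 0) * (if xz.2 β % (Lc : ℤ) = (Lc : ℤ) - 1 then (1 : ℝ) else 0))
            * SpureRecAt d Lc (toSite (ctrOff (d + 1) Lc)) ((Lc : ℝ) ^ (d + 1)) (-((Lc : ℝ) ^ (d + 1) * (1 / 2) * (Lc : ℝ) ^ (d + 1))) cΛ (0 + 1) κ u xz.1 xz.2 (Sum.inl α) (Sum.inl β))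
          + ∑ ρ' : Fin (d + 1), ∑' w : Site (d + 1),
            colM (coDressKBmAt (toSite (ctrOff (d + 1) Lc)) Lc (KInvStep (d := d) Lc (0 + 1))) Lc ν y' ρ' w
              * ((if y' = y then (1 / 2 : ℝ) else 0) - (if w = y then (1 / 2 : ℝ) else 0))
              * ∑' xz : Site (d + 1) × Site (d + 1), ((if xz.1 α % (Lc : ℤ) = (Lc : ℤ) - 1 then (1 : ℝ) else 0) * (if xz.2 β % (Lc : ℤ) = (Lc : ℤ) - 1 then (1 : ℝ) else 0))
            * M1At d Lc (toSite (ctrOff (d + 1) Lc)) cΛ (0 + 1) ρ' w xz.1 xz.2 (Sum.inl α) (Sum.inl β))))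
    (hVend : ∀ y' : Site (d + 1), Vend y' = ((1 / 2 : ℝ) *
        ((∑ κ : Fin (d + 1), ∑' u : Site (d + 1),
            colH (coDressKBmAt (toSite (ctrOff (d + 1) Lc)) Lc (KInvStep (d := d) Lc (0 + 1))) Lc ν y' κ u
              * ((if y' + Pi.single ν 1 = y then (1 / 2 : ℝ) else 0) - (if blk Lc (u + Pi.single κ 1) = y then (1 / 2 : ℝ) else 0))
              * ∑' xz : Site (d + 1) × Site (d + 1), ((if xz.1 α % (Lc : ℤ) = (Lc : ℤ) - 1 then (1 : ℝ) else 0) * (if xz.2 β % (Lc : ℤ) = (Lc : ℤ) - 1 then (1 : ℝ) else 0))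
            * SpureRecAt d Lc (toSite (ctrOff (d + 1) Lc)) ((Lc : ℝ) ^ (d + 1)) (-((Lc : ℝ) ^ (d + 1) * (1 / 2) * (Lc : ℝ) ^ (d + 1))) cΛ (0 + 1) κ u xz.1 xz.2 (Sum.inl α) (Sum.inl β))
          + ∑ ρ' : Fin (d + 1), ∑' w : Site (d + 1),
            colM (coDressKBmAt (toSite (ctrOff (d + 1) Lc)) Lc (KInvStep (d := d) Lc (0 + 1))) Lc ν y' ρ' w
              * ((if y' + Pi.single ν 1 = y then (1 / 2 : ℝ) else 0) - (if w + Pi.single ρ' 1 = y then (1 / 2 : ℝ) else 0))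
              * ∑' xz : Site (d + 1) × Site (d + 1), ((if xz.1 α % (Lc : ℤ) = (Lc : ℤ) - 1 then (1 : ℝ) else 0) * (if xz.2 β % (Lc : ℤ) = (Lc : ℤ) - 1 then (1 : ℝ) else 0))
            * M1At d Lc (toSite (ctrOff (d + 1) Lc)) cΛ (0 + 1) ρ' w xz.1 xz.2 (Sum.inl α) (Sum.inl β))))
    (hQc : ∀ y' : Site (d + 1), Qc y' = (∑ κ : Fin (d + 1), ∑' u : Site (d + 1),
        (∑' x₂, ∑ κ₂, comp (coDressKBmAt (toSite (ctrOff (d + 1) Lc)) Lc (KInvStep (d := d) Lc (0 + 1)))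
            (dM (coDressKBmAt (toSite (ctrOff (d + 1) Lc)) Lc (KInvStep (d := d) Lc (0 + 1))) Lc (SpureRecAt d Lc (toSite (ctrOff (d + 1) Lc)) ((Lc : ℝ) ^ (d + 1)) (-((Lc : ℝ) ^ (d + 1) * (1 / 2) * (Lc : ℝ) ^ (d + 1))) cΛ (0 + 1)) (M1At d Lc (toSite (ctrOff (d + 1) Lc)) cΛ (0 + 1)) ν y')
            u x₂ (Sum.inl κ) (Sum.inl κ₂) * gaugeWt Lc y κ₂ x₂)
          * ∑' xz : Site (d + 1) × Site (d + 1), ((if xz.1 α % (Lc : ℤ) = (Lc : ℤ) - 1 then (1 : ℝ) else 0) * (if xz.2 β % (Lc : ℤ) = (Lc : ℤ) - 1 then (1 : ℝ) else 0))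
            * SpureRecAt d Lc (toSite (ctrOff (d + 1) Lc)) ((Lc : ℝ) ^ (d + 1)) (-((Lc : ℝ) ^ (d + 1) * (1 / 2) * (Lc : ℝ) ^ (d + 1))) cΛ (0 + 1) κ u xz.1 xz.2 (Sum.inl α) (Sum.inl β)
      + ∑ ρ' : Fin (d + 1), ∑' w : Site (d + 1),
        (∑' x₂, ∑ κ₂, comp (coDressKBmAt (toSite (ctrOff (d + 1) Lc)) Lc (KInvStep (d := d) Lc (0 + 1)))
            (dM (coDressKBmAt (toSite (ctrOff (d + 1) Lc)) Lc (KInvStep (d := d) Lc (0 + 1))) Lc (SpureRecAt d Lc (toSite (ctrOff (d + 1) Lc)) ((Lc : ℝ) ^ (d + 1)) (-((Lc : ℝ) ^ (d + 1) * (1 / 2) * (Lc : ℝ) ^ (d + 1))) cΛ (0 + 1)) (M1At d Lc (toSite (ctrOff (d + 1) Lc)) cΛ (0 + 1)) ν y')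
            ((Lc : ℤ) • w) x₂ (Sum.inr ρ') (Sum.inl κ₂) * gaugeWt Lc y κ₂ x₂)
          * ∑' xz : Site (d + 1) × Site (d + 1), ((if xz.1 α % (Lc : ℤ) = (Lc : ℤ) - 1 then (1 : ℝ) else 0) * (if xz.2 β % (Lc : ℤ) = (Lc : ℤ) - 1 then (1 : ℝ) else 0))
            * M1At d Lc (toSite (ctrOff (d + 1) Lc)) cΛ (0 + 1) ρ' w xz.1 xz.2 (Sum.inl α) (Sum.inl β))) :
    (∑' y' : Site (d + 1), (Vα y' - (1 / 2 : ℝ) * (stepScale d Lc (0 + 1) * (Lc : ℝ) ^ (d + 1))⁻¹ * Qc y') = 0)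
      ∧ ∀ lam : Fin (d + 1),
        ∑' y' : Site (d + 1), (((y' - y) lam : ℤ) : ℝ) * (Vα y' - (1 / 2 : ℝ) * (stepScale d Lc (0 + 1) * (Lc : ℝ) ^ (d + 1))⁻¹ * Qc y') = 0 :=
  moments_sigmaPair_exit_succ hLc cΛ 0 y ν hαβ hVα hVend hQc

end Summit.QuantumFields.BalabanUV.Beta.GAN24.SlotMomentExitPairLevels

end
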